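import Summits.Ventures.DiscreteObjects.PP12.OrderElevenTriangleLift

/-!
# PP(12), order-11 cell, Case B converse: in the structure built from valid `TriangleData 11` two distinct lines meet exactly once (kernel; proofs)
Framing: lottery ticket; floor = certified bounds/negative ranges.

Cell pub-namedobj (venture DiscreteObjects), target (M), designs gen 16. Part 2a of the converse of `OrderElevenTriangleValid`: for
`D : TriangleData 11` with `D.Valid`, in the structure `VPt D` / `VLn D` of `OrderElevenTriangleLift`, **two distinct lines meet in exactly
one point** (`exists_meet`, `meet_unique`) — side/side: the third vertex; side/pencil and side/free: a vertex or a side point; pencil/pencil of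
different vertices: (Φ); pencil/free: (K) (`partK`); free/free: (D) and the trichotomy (X). The plane, its order, the shift collineation and
`NoOrderElevenOrder12 → NoTriangleData12` follow in `OrderElevenTriangleLiftPlane`. Proofs only; nothing asserted. No `sorry`, no new axioms.
-/

namespace Summit.Ventures.DiscreteObjects.PP12

open Configuration Finset

namespace TriLift11

variable {D : TriangleData 11}

/-! ### Two distinct lines meet in exactly one point -/

/-- **existence of the meet** -/
theorem exists_meet (hD : D.Valid) (l₁ l₂ : VLn D) (hne : l₁ ≠ l₂) : ∃ p : VPt D, p ∈ l₁ ∧ p ∈ l₂ := by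
  rcases l₁ with k | ⟨k, y⟩ | ⟨s, y⟩ <;> rcases l₂ with k' | ⟨k', y'⟩ | ⟨s', y'⟩
  · -- side / side: the third vertex
    have hkk' : k ≠ k' := fun e => hne (by rw [e])
    obtain ⟨m, hm, hm', -⟩ := fin3_third k k' hkk'
    exact ⟨VPt.vx m, by simpa using hm, by simpa using hm'⟩
  · -- side k / pencil k'
    by_cases hkk' : k = k'
    · subst hkk'; exact ⟨VPt.sp k y', by simp, by simp⟩
    · exact ⟨VPt.vx k', by simpa using (Ne.symm hkk'), by simp⟩
  · exact ⟨VPt.sp k (y' + goff D k s'), by simp, by simp⟩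
  · by_cases hkk' : k' = k
    · subst hkk'; exact ⟨VPt.sp k' y, by simp, by simp⟩
    · exact ⟨VPt.vx k, by simp, by simpa using (Ne.symm hkk')⟩
  · -- pencil / pencil
    by_cases hkk' : k = k'
    · subst hkk'; exact ⟨VPt.vx k, by simp, by simp⟩
    · -- different vertices: the free point
      have key : ∃ t, y + poff D k t = y' + poff D k' t := by
        fin_cases k <;> fin_cases k'
        all_goals first | exact absurd rfl hkk' | skip
        · exact ⟨y - y', by simp⟩
        · obtain ⟨t, ht, -⟩ := exists_phi_eq hD (y - y'); exact ⟨t, by simp [ht]⟩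
        · exact ⟨y' - y, by simp⟩
        · obtain ⟨t, ht, -⟩ := exists_sub_phi_eq hD (y' - y)
          refine ⟨t, ?_⟩; simp only [poff]; simp
          rw [add_comm y t]; exact sub_eq_sub_iff_add_eq_add.1 ht
        · obtain ⟨t, ht, -⟩ := exists_phi_eq hD (y' - y); exact ⟨t, by simp [ht]⟩
        · obtain ⟨t, ht, -⟩ := exists_sub_phi_eq hD (y - y')
          refine ⟨t, ?_⟩; simp only [poff]; simp
          have e := sub_eq_sub_iff_add_eq_add.1 ht; rw [add_comm t y'] at e; exact e.symm
      obtain ⟨t, ht⟩ := key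
      exact ⟨VPt.fr t (y + poff D k t), by simp, by rw [fr_mem_pl]; exact ht⟩
  · -- pencil (k, y) / free (s', y')
    by_cases hz : y - y' = goff D k s'
    · exact ⟨VPt.sp k y, by simp, by rw [sp_mem_fl, ← hz]; abel⟩
    · obtain ⟨t, ht, -⟩ := (partK hD k s').2 (y - y') hz
      exact ⟨VPt.fr t (y + poff D k t), by simp, by rw [fr_mem_fl]; convert ht using 2; abel⟩
  · exact ⟨VPt.sp k' (y + goff D k' s), by simp, by simp⟩
  · by_cases hz : y' - y = goff D k' s
    · exact ⟨VPt.sp k' y', by rw [sp_mem_fl, ← hz]; abel, by simp⟩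
    · obtain ⟨t, ht, -⟩ := (partK hD k' s).2 (y' - y) hz
      exact ⟨VPt.fr t (y' + poff D k' t), by rw [fr_mem_fl]; convert ht using 2; abel, by simp⟩
  · -- free / free
    by_cases hss' : s = s'
    · subst hss'
      have hyy' : y' - y ≠ 0 := fun h => hne (by rw [sub_eq_zero.1 h])
      obtain ⟨t, z, h1, h2⟩ := exists_internal hD s hyy'
      refine ⟨VPt.fr t (z + y), by simpa using h1, ?_⟩
      rw [fr_mem_fl]; convert h2 using 2; abel
    · by_cases hyy : y = y'
      · subst hyy; exact ⟨VPt.sp 0 y, by simp, by simp⟩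
      · have hyy' : y' - y ≠ 0 := fun h => hyy (sub_eq_zero.1 h).symm
        rcases cross_trichotomy hD hss' hyy' with ⟨h1, -, -⟩ | ⟨-, h2, -⟩ | ⟨-, -, t, z, h1, h2, -⟩
        · refine ⟨VPt.sp 1 (y + D.g1 s), by simp, ?_⟩
          rw [sp_mem_fl, goff_one, add_comm y]; exact sub_eq_sub_iff_add_eq_add.1 h1
        · refine ⟨VPt.sp 2 (y + D.g2 s), by simp, ?_⟩
          rw [sp_mem_fl, goff_two, add_comm y]; exact sub_eq_sub_iff_add_eq_add.1 h2
        · refine ⟨VPt.fr t (z + y), by simpa using h1, ?_⟩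
          rw [fr_mem_fl]; convert h2 using 2; abel

/-- **uniqueness of the meet** -/
theorem meet_unique (hD : D.Valid) {l₁ l₂ : VLn D} (hne : l₁ ≠ l₂) {p₁ p₂ : VPt D} (h1 : p₁ ∈ l₁) (h2 : p₂ ∈ l₁) (h3 : p₁ ∈ l₂)
    (h4 : p₂ ∈ l₂) : p₁ = p₂ := by
  rcases l₁ with k | ⟨k, y⟩ | ⟨s, y⟩ <;> rcases l₂ with k' | ⟨k', y'⟩ | ⟨s', y'⟩
  · -- side / side
    have hkk' : k ≠ k' := fun e => hne (by rw [e])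
    obtain ⟨m, -, -, hm⟩ := fin3_third k k' hkk'
    rcases p₁ with a | ⟨a, xa⟩ | ⟨ta, xa⟩ <;> rcases p₂ with b | ⟨b, xb⟩ | ⟨tb, xb⟩ <;>
      simp only [vx_mem_sd, sp_mem_sd, fr_mem_sd] at h1 h2 h3 h4
    · rw [hm a h1 h3, hm b h2 h4]
    · exact absurd (h2.symm.trans h4) hkk'
    · exact absurd (h1.symm.trans h3) hkk'
    · exact absurd (h1.symm.trans h3) hkk'
  · -- side k / pencil k'
    rcases p₁ with a | ⟨a, xa⟩ | ⟨ta, xa⟩ <;> rcases p₂ with b | ⟨b, xb⟩ | ⟨tb, xb⟩ <;>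
      simp only [vx_mem_sd, vx_mem_pl, sp_mem_sd, sp_mem_pl, fr_mem_sd] at h1 h2 h3 h4
    · rw [h3, h4]
    · exact absurd (h4.1.symm.trans h2) (h3 ▸ h1)
    · exact absurd (h3.1.symm.trans h1) (h4 ▸ h2)
    · rw [h1, ← h2, h3.2, h4.2]
  · -- side k / free
    rcases p₁ with a | ⟨a, xa⟩ | ⟨ta, xa⟩ <;> rcases p₂ with b | ⟨b, xb⟩ | ⟨tb, xb⟩ <;>
      simp only [vx_mem_fl, sp_mem_sd, sp_mem_fl, fr_mem_sd] at h1 h2 h3 h4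
    subst h1; subst h2; rw [h3, h4]
  · -- pencil k / side k'
    rcases p₁ with a | ⟨a, xa⟩ | ⟨ta, xa⟩ <;> rcases p₂ with b | ⟨b, xb⟩ | ⟨tb, xb⟩ <;>
      simp only [vx_mem_sd, vx_mem_pl, sp_mem_sd, sp_mem_pl, fr_mem_sd] at h1 h2 h3 h4
    · rw [h1, h2]
    · exact absurd (h2.1.symm.trans h4) (h1 ▸ h3)
    · exact absurd (h1.1.symm.trans h3) (h2 ▸ h4)
    · rw [h3, ← h4, h1.2, h2.2]
  · -- pencil / pencil
    rcases p₁ with a | ⟨a, xa⟩ | ⟨ta, xa⟩ <;> rcases p₂ with b | ⟨b, xb⟩ | ⟨tb, xb⟩ <;>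
      simp only [vx_mem_pl, sp_mem_pl, fr_mem_pl] at h1 h2 h3 h4
    · rw [h1, h2]
    · subst h1; subst h3; obtain ⟨-, rfl⟩ := h2; obtain ⟨-, e⟩ := h4; subst e; exact absurd rfl hne
    · subst h1; subst h3
      have e : y = y' := add_right_cancel (h2.symm.trans h4)
      subst e; exact absurd rfl hne
    · subst h2; subst h4; obtain ⟨-, rfl⟩ := h1; obtain ⟨-, e⟩ := h3; subst e; exact absurd rfl hne
    · rw [h1.1, h1.2, h2.1, h2.2]
    · obtain ⟨e1, e2⟩ := h1; obtain ⟨e3, e4⟩ := h3; subst e1; subst e2; subst e3; subst e4; exact absurd rfl hne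
    · subst h2; subst h4
      have e : y = y' := add_right_cancel (h1.symm.trans h3)
      subst e; exact absurd rfl hne
    · obtain ⟨e1, e2⟩ := h2; obtain ⟨e3, e4⟩ := h4; subst e1; subst e2; subst e3; subst e4; exact absurd rfl hne
    · -- fr / fr
      by_cases hkk' : k = k'
      · subst hkk'
        have : y = y' := by
          have e := h1.symm.trans h3
          exact add_right_cancel e
        subst this; exact absurd rfl hne
      · have key : ∀ t t' : Fin 11, y + poff D k t = y' + poff D k' t → y + poff D k t' = y' + poff D k' t' → t = t' := by
          intro t t' e e'
          fin_cases k <;> fin_cases k'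
          all_goals first | exact absurd rfl hkk' | skip
          all_goals simp only [poff] at e e'; simp at e e'
          · exact add_left_cancel (e.symm.trans e')
          · exact hD.1.1 t t' (add_left_cancel (e.symm.trans e'))
          · exact add_left_cancel (e.trans e'.symm)
          · apply hD.1.2 t t'
            have h5 : t - D.phi t = y' - y := by rw [sub_eq_sub_iff_add_eq_add, add_comm t, ← e, add_comm]
            have h6 : t' - D.phi t' = y' - y := by rw [sub_eq_sub_iff_add_eq_add, add_comm t', ← e', add_comm]
            rw [h5, h6]
          · exact hD.1.1 t t' (add_left_cancel (e.trans e'.symm))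
          · apply hD.1.2 t t'
            have h5 : t - D.phi t = y - y' := by rw [sub_eq_sub_iff_add_eq_add, add_comm t, e, add_comm]
            have h6 : t' - D.phi t' = y - y' := by rw [sub_eq_sub_iff_add_eq_add, add_comm t', e', add_comm]
            rw [h5, h6]
        have htt := key ta tb (h1.symm.trans h3) (h2.symm.trans h4)
        subst htt; rw [h1, h2]
  · -- pencil (k, y) / free (s', y')
    rcases p₁ with a | ⟨a, xa⟩ | ⟨ta, xa⟩ <;> rcases p₂ with b | ⟨b, xb⟩ | ⟨tb, xb⟩ <;>
      simp only [vx_mem_fl, sp_mem_pl, sp_mem_fl, fr_mem_pl, fr_mem_fl] at h1 h2 h3 h4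
    · obtain ⟨rfl, rfl⟩ := h1; obtain ⟨rfl, rfl⟩ := h2; rfl
    · -- sp a xa, fr tb xb : xa = y, xa = y' + goff ⇒ the excluded cell
      obtain ⟨rfl, rfl⟩ := h1
      subst h2
      have e : y' + goff D a s' + poff D a tb - y' = goff D a s' + poff D a tb := by abel
      rw [h3, e, (partK hD a s').1 tb] at h4; exact absurd h4 (by simp)
    · obtain ⟨rfl, rfl⟩ := h2
      subst h1
      have e : y' + goff D b s' + poff D b ta - y' = goff D b s' + poff D b ta := by abel
      rw [h4, e, (partK hD b s').1 ta] at h3; exact absurd h3 (by simp)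
    · subst h1; subst h2
      have e1 : D.mem s' ta (y - y' + poff D k ta) = true := by convert h3 using 2; abel
      have e2 : D.mem s' tb (y - y' + poff D k tb) = true := by convert h4 using 2; abel
      rw [partK_unique hD k s' e1 e2]
  · -- free / side k'
    rcases p₁ with a | ⟨a, xa⟩ | ⟨ta, xa⟩ <;> rcases p₂ with b | ⟨b, xb⟩ | ⟨tb, xb⟩ <;>
      simp only [vx_mem_fl, sp_mem_sd, sp_mem_fl, fr_mem_sd] at h1 h2 h3 h4
    subst h3; subst h4; rw [h1, h2]
  · -- free (s, y) / pencil (k', y')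
    rcases p₁ with a | ⟨a, xa⟩ | ⟨ta, xa⟩ <;> rcases p₂ with b | ⟨b, xb⟩ | ⟨tb, xb⟩ <;>
      simp only [vx_mem_fl, sp_mem_pl, sp_mem_fl, fr_mem_pl, fr_mem_fl] at h1 h2 h3 h4
    · obtain ⟨rfl, rfl⟩ := h3; obtain ⟨rfl, rfl⟩ := h4; rfl
    · obtain ⟨rfl, rfl⟩ := h3
      subst h4
      have e : y + goff D a s + poff D a tb - y = goff D a s + poff D a tb := by abel
      rw [h1, e, (partK hD a s).1 tb] at h2; exact absurd h2 (by simp)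
    · obtain ⟨rfl, rfl⟩ := h4
      subst h3
      have e : y + goff D b s + poff D b ta - y = goff D b s + poff D b ta := by abel
      rw [h2, e, (partK hD b s).1 ta] at h1; exact absurd h1 (by simp)
    · subst h3; subst h4
      have e1 : D.mem s ta (y' - y + poff D k' ta) = true := by convert h1 using 2; abel
      have e2 : D.mem s tb (y' - y + poff D k' tb) = true := by convert h2 using 2; abel
      rw [partK_unique hD k' s e1 e2]
  · -- free / free
    rcases p₁ with a | ⟨a, xa⟩ | ⟨ta, xa⟩ <;> rcases p₂ with b | ⟨b, xb⟩ | ⟨tb, xb⟩ <;>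
      simp only [vx_mem_fl, sp_mem_fl, fr_mem_fl] at h1 h2 h3 h4
    · -- two side points: positions
      by_cases hss' : s = s'
      · subst hss'
        have hy : y = y' := add_right_cancel (h1.symm.trans h3)
        subst hy; exact absurd rfl hne
      · by_cases hab : a = b
        · subst hab; rw [h1, h2]
        · -- two different side points common to B_s^y and B_s'^y' contradict the trichotomy
          exfalso
          have pos : ∀ {c : Fin 3} {x : Fin 11}, x = y + goff D c s → x = y' + goff D c s' → goff D c s - goff D c s' = y' - y := by
            intro c x e e'; rw [sub_eq_sub_iff_add_eq_add, add_comm (goff D c s)]; exact e.symm.trans e'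
          have pa := pos h1 h3
          have pb := pos h2 h4
          by_cases hyy : y = y'
          · subst hyy
            rw [sub_self, sub_eq_zero] at pa pb
            rcases eq_or_ne a 0 with ha0 | ha0
            · exact goff_ne hD hss' (fun hb0 => hab (ha0.trans hb0.symm)) pb
            · exact goff_ne hD hss' ha0 pa
          · have hyy' : y' - y ≠ 0 := fun h => hyy (sub_eq_zero.1 h).symm
            have T := cross_trichotomy hD hss' hyy'
            -- a, b ∈ {1, 2} distinct (a position 0 forces y = y')
            have ha0 : a ≠ 0 := fun ha0 => by subst ha0; exact hyy' (by simpa using pa.symm)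
            have hb0 : b ≠ 0 := fun hb0 => by subst hb0; exact hyy' (by simpa using pb.symm)
            have h12 : (D.g1 s - D.g1 s' = y' - y) ∧ (D.g2 s - D.g2 s' = y' - y) := by
              fin_cases a <;> fin_cases b
              all_goals first | exact absurd rfl hab | exact absurd rfl ha0 | exact absurd rfl hb0 | skip
              · exact ⟨by simpa using pa, by simpa using pb⟩
              · exact ⟨by simpa using pb, by simpa using pa⟩
            rcases T with ⟨-, h2', -⟩ | ⟨h1', -, -⟩ | ⟨h1', -, -⟩
            · exact h2' h12.2
            · exact h1' h12.1
            · exact h1' h12.1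
    · -- side point and free point
      exfalso
      by_cases hss' : s = s'
      · subst hss'
        have hy : y ≠ y' := fun e => hne (by rw [e])
        -- the side point forces y' - y = 0 unless a ≠ 0 … in all cases contradiction via positions/internal
        have pa : y + goff D a s = y' + goff D a s := h1.symm.trans h3
        exact hy (add_right_cancel pa)
      · by_cases hyy : y = y'
        · subst hyy; exact pairNone_zero hD hss' tb _ ⟨h2, h4⟩
        · have hyy' : y' - y ≠ 0 := fun h => hyy (sub_eq_zero.1 h).symm
          have pa : goff D a s - goff D a s' = y' - y := by
            rw [sub_eq_sub_iff_add_eq_add, add_comm (goff D a s)]; exact h1.symm.trans h3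
          have ha0 : a ≠ 0 := fun ha0 => by subst ha0; exact hyy' (by simpa using pa.symm)
          have e4 : D.mem s' tb (xb - y - (y' - y)) = true := by convert h4 using 2; abel
          rcases cross_trichotomy hD hss' hyy' with ⟨-, h2', hN⟩ | ⟨h1', -, hN⟩ | ⟨h1', h2', -⟩
          · exact hN tb (xb - y) ⟨h2, e4⟩
          · exact hN tb (xb - y) ⟨h2, e4⟩
          · fin_cases a
            · exact ha0 rfl
            · exact h1' (by simpa using pa)
            · exact h2' (by simpa using pa)
    · exfalso
      by_cases hss' : s = s'
      · subst hss'
        have hy : y ≠ y' := fun e => hne (by rw [e])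
        have pb : y + goff D b s = y' + goff D b s := h2.symm.trans h4
        exact hy (add_right_cancel pb)
      · by_cases hyy : y = y'
        · subst hyy; exact pairNone_zero hD hss' ta _ ⟨h1, h3⟩
        · have hyy' : y' - y ≠ 0 := fun h => hyy (sub_eq_zero.1 h).symm
          have pb : goff D b s - goff D b s' = y' - y := by
            rw [sub_eq_sub_iff_add_eq_add, add_comm (goff D b s)]; exact h2.symm.trans h4
          have hb0 : b ≠ 0 := fun hb0 => by subst hb0; exact hyy' (by simpa using pb.symm)
          have e3 : D.mem s' ta (xa - y - (y' - y)) = true := by convert h3 using 2; abel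
          rcases cross_trichotomy hD hss' hyy' with ⟨-, h2', hN⟩ | ⟨h1', -, hN⟩ | ⟨h1', h2', -⟩
          · exact hN ta (xa - y) ⟨h1, e3⟩
          · exact hN ta (xa - y) ⟨h1, e3⟩
          · fin_cases b
            · exact hb0 rfl
            · exact h1' (by simpa using pb)
            · exact h2' (by simpa using pb)
    · -- two free points
      by_cases hss' : s = s'
      · subst hss'
        have hyy' : y' - y ≠ 0 := fun h => hne (by rw [sub_eq_zero.1 h])
        have e3 : D.mem s ta (xa - y - (y' - y)) = true := by convert h3 using 2; abel
        have e4 : D.mem s tb (xb - y - (y' - y)) = true := by convert h4 using 2; abel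
        obtain ⟨e1, e2⟩ := internal_unique hD s hyy' h1 e3 h2 e4
        subst e1; have := sub_left_injective e2; subst this; rfl
      · by_cases hyy : y = y'
        · subst hyy; exact absurd ⟨h1, h3⟩ (pairNone_zero hD hss' ta _)
        · have hyy' : y' - y ≠ 0 := fun h => hyy (sub_eq_zero.1 h).symm
          have e3 : D.mem s' ta (xa - y - (y' - y)) = true := by convert h3 using 2; abel
          have e4 : D.mem s' tb (xb - y - (y' - y)) = true := by convert h4 using 2; abel
          rcases cross_trichotomy hD hss' hyy' with ⟨-, -, hN⟩ | ⟨-, -, hN⟩ | ⟨-, -, t₀, x₀, -, -, huniq⟩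
          · exact absurd ⟨h1, e3⟩ (hN ta (xa - y))
          · exact absurd ⟨h1, e3⟩ (hN ta (xa - y))
          · obtain ⟨e1, e2⟩ := huniq ta (xa - y) h1 e3
            obtain ⟨e1', e2'⟩ := huniq tb (xb - y) h2 e4
            have htt : ta = tb := e1.trans e1'.symm
            subst htt; have := sub_left_injective (e2.trans e2'.symm); subst this; rfl

end TriLift11

end Summit.Ventures.DiscreteObjects.PP12
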